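import Summits.CriticalPhenomena.SAWScalingLimit.Theses.SAWLeftRightFKG
import Literature.Probability.RandomPlanarGeometry.CrossingCondition

/-!
# Line `carve-reroot-drill` — skeleton for crux `FKGToTraversalBound` (stmt-CriticalPhenomena-1878)

Crux (route `SAWLeftRightFKG`, rank 3): `FKGToTraversalBound := LeftRightFKG → SAWTraversalBound`
(`Iff.rfl`, Disproof §1 `iff_imp`): left–right positive association (PA) of the critical square-lattice
SAW chord measure in simply connected lattice domains between boundary-adjacent endpoints should give
the Aizenman–Burchard hypothesis (H1) for the chordal critical SAW in EVERY Dobrushin domain and for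
EVERY endpoint approximation.

Idea (card `Ideas/carve-reroot-drill.md`, ideator 2; triage r1-1/2/3: pass ×3): the one consequence
of PA an annulus argument can consume is the pair of one-sided HULL MONOTONICITIES (CARVE: deleting
material attached to the OPPOSITE boundary arc raises the probability of entering a pocket hanging off
this arc; FILL/EXCAVATE: the same-side companions) — PA applied to an up-set and the complement of a
down-set, read through the exact restriction property of the `x_c^{|γ|}` law.  Carving the opposite arc
down to a width-one collar with necks at a pocket's lips and stopping the chord at the in-neck (exact
domain Markov property + the bead factorisation of a chord through cut vertices) RE-ROOTS
Kemppainen–Smirnov's Condition G2 for the critical SAW: the sup over pasts and over the outside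
geometry disappears, and what is left is an UNCONDITIONED bound for LIP-TO-LIP chords of a ROOTED ROOM
(a lattice domain `encl δ (W₁ ++ W₂)` whose boundary walk is split into a LINTEL `W₁` and WALLS `W₂`,
the chord running between the two lips `u ∼ u'`, `v ∼ v'` of the lintel).

This skeleton makes that reduction precise and honest about its two residues:

* PIVOT.  The re-rooted statements are chained into Kemppainen–Smirnov's TIME-ZERO Condition G1 for
  the ADMISSIBLE family (critical SAW in simply connected polyomino cell domains between boundary
  vertices) — `AdmissibleG1`, which is VERBATIM the shared item `SAWParafermion.KSAdmissibleG1`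
  (stmt-CriticalPhenomena-11346; `Iff.rfl` once both files are imported).  By KS §4.1.6 (the SAW has
  the exact domain Markov property `S ↦ S ∖ {v₀,…,v_{k-1}}`, tip and target stay boundary vertices)
  this is Condition G2 in substance for the chordal critical SAW started AT THE BOUNDARY.
* TWO SEEDS, not one (planner's finding, KS arXiv:1212.6215 pp. 11–12 read): Condition G1 bounds the
  UNION over all avoidable components of an annulus, and a flat per-room bound `≤ 1/2` does not sum
  over the unboundedly many dead-end pockets a rough wall hangs into one annulus.  KS's own device
  (proof of `(cond:quadexp) ⇒ (G2)`: a separating family of arcs `I_j` with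
  `Σ_j exp(-ε ℓ(I_j)) < 1/(2K)`, `ℓ(I) = ∫₀ˣ dy/|I^y(I)|`, by a Jensen induction over the tree of arcs)
  consumes bounds that are EXPONENTIAL in the conformal length of the approach to an arc.  Chaining
  rooted rooms along the gates `I^y(I)` of a pocket produces exactly such bounds, but only with BOTH
  kinds of step: an EXPANSION step (from a gate of size `g` the chord rarely travels `C₀ g` farther:
  `RootedExitBound`, the card's `TExitBound` generalised to arbitrary rooms — "x_c-arches are tight at
  the scale of their own lintel") and an AIMING step (the chord rarely hits a ball of radius `r` whose
  distance from the lintel is `≥ C₀ r`: `RootedDiveBound`, the card's `RootedAnnulusBound` REPAIRED as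
  all three triagers required — unforcedness clause, `C₀ > 2`, mesh floor `δ ≤ r`).  Funnels closing
  faster than aspect ratio `C₀` defeat the expansion step alone; widening horns behind a narrow gate
  defeat the aiming step alone (see the line card).
* KS DOWNSTREAM on TAME meshes only.  `AdmissibleG1 → TameTraversalBound`: KS Lemma 3.6 / Prop. 3.5
  (index of an annulus, monochromatic components, `(n - n₀)/2` applications of G1 ⇒ G3) run in the
  Euclidean domain with the forced-crossing count `n₀ = N₀(x, ρ, R)` (bounded uniformly in small `δ`
  for a Jordan domain; absorbed by the shell-dependent threshold `k x ρ R`, Disproof F2) — for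
  endpoint approximations whose meshes are eventually TAME: the discrete domain `Ω_δ` is a simply
  connected polyomino on which the mesh graph is induced, and `a_δ, b_δ` are boundary vertices
  (`IsTameMesh`; every convex domain with boundary-adjacent endpoints qualifies).  This is the class on
  which the conditional futures of the exploration stay inside the admissible family.
* THE RESIDUE, named and not hidden: `stub_classExtension : TameTraversalBound → SAWTraversalBound`.
  It is NOT served by the lever and is shared by every line on this crux: (i) DEEP endpoint
  approximations (Disproof F3 `exists_isEndpointApprox_deepStart`, `not_presentable_of_enclosed`;
  triage X1/S1/P1: with a floating past Condition G2 is FALSE for the critical SAW, two-corridor ring,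
  `P(unforced crossing | past) = .905 → .996`), (ii) sub-mesh roughness of a general Jordan boundary
  (non-induced mesh edges, lattice holes of `Ω_δ`, Disproof F3(c)).  The honest statement-level repair
  is the route planner's (R1): restrict (H1) to boundary-vertex approximations + a separate
  deep-endpoint item; then this stub disappears.

`FKGToTraversalBound_of : FKGToTraversalBound` concludes the crux BY NAME; its term is the composition
`stub_classExtension ∘ stub_ksDownstream ∘ (stub_reroot · stub_exitSeed stub_diveSeed)` of the five
registered stubs, i.e. `RootedExitBound → RootedDiveBound → (LeftRightFKG → RootedExitBound →
RootedDiveBound → AdmissibleG1) → (AdmissibleG1 → TameTraversalBound) → (TameTraversalBound →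
SAWTraversalBound) → FKGToTraversalBound`.  `sorry` occurs only in the five `stub_*` theorems.  PROVED
here (sorry-free): the up×down complement form of PA with finite total weight
(`inter_mul_univ_le_of_PA`, abstract; `carveCore_of_leftRightFKG`, the route's order and weight) — the
formal core of CARVE/FILL that `stub_reroot` consumes first (triage X3: one `--supports` lemma for the
three PA cards).  The hypothesis `LeftRightFKG` is consumed at `stub_reroot` and
nowhere else (Disproof F1 `mono_hyp`: the prover may — and by F3 must — replace PA by the hull
monotonicities it actually uses; the recommended first `--supports` lemma is the up×down form
`w(E ∩ D)·w(univ) ≤ w(E)·w(D)`, triage X3, identical for cards carve-fill-sandwich / lid-collapse-needle).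
-/

noncomputable section

open MeasureTheory Filter Topology Set Metric
open scoped NNReal ENNReal
open Literature.Probability.LatticeModels
open Literature.Probability.RandomPlanarGeometry
open Summit.CriticalPhenomena.SAWScalingLimit.Theses.SAWLeftRightFKG

namespace Summit.CriticalPhenomena.SAWScalingLimit.Cruxes.FKGToTraversalBound.CarveRerootDrill

/-! ## Vocabulary (rooted rooms; the admissible family; tame meshes) -/

/-- The lattice domain ENCLOSED by a closed lattice walk `C` at mesh `δ` (slits allowed): the points of
non-zero winding number of the mesh polyline of `C` — verbatim the `Ω` of the route's `LeftRightFKG`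
(and `Theorems.FKGToTraversalBound.Negative.dom`).  Its mesh graph is the subgraph of `ℤ²` INDUCED on
`{x | wind ≠ 0 at δx}` (a primal boundary walk cannot separate two adjacent off-trace sites), its
vertex set has no floating holes (`Negative.noFloatingHoles`), and the vertices of `C` are not sites
(junk `wind = 0` on the trace).  A ROOTED ROOM is `encl δ (W₁ ++ W₂)` with the boundary walk split
into the LINTEL `W₁ : u' → v'` and the WALLS `W₂ : v' → u'`; its chords run between the LIPS
`u ∼ u'`, `v ∼ v'`. -/
def encl (δ : ℝ) {c : Site 2} (C : (zdGraph 2).Walk c c) : Set ℂ :=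
  {z | Literature.Topology.PlaneTopology.wind
      (fun t : ℝ => Set.IccExtend zero_le_one (C.toCurve (meshPoint δ)) t - z) ≠ 0}

/-- The route's LEFT–RIGHT ORDER on chords of `encl δ C` from `a` to `b` (verbatim the `le` of
`LeftRightFKG`): the lens loop `γ₁ · γ₂⁻¹` has winding number `≥ 0` about every point. -/
def lr (δ : ℝ) {c : Site 2} (C : (zdGraph 2).Walk c c) (a b : Site 2)
    (γ₁ γ₂ : SAW.DomainSAW (encl δ C) δ a b) : Prop :=
  ∀ z : ℂ, 0 ≤ Literature.Topology.PlaneTopology.wind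
    (fun t : ℝ => Set.IccExtend zero_le_one
      ((γ₁.walk.append γ₂.walk.reverse).toCurve (meshPoint δ)) t - z)

/-- **Rooted exit bound** (seed 1, the EXPANSION step; the card's `TExitBound` for arbitrary rooms).
For every `C₁ ≥ 1` there is `C₀ > C₁` such that for every mesh `δ > 0`, every rooted room with a
lintel `W₁` of at least one edge, and lips `u ∼ u'`, `v ∼ v'` that are joined INSIDE THE ROOM by a
lattice walk staying within distance `C₁ · δ|W₁|` of the lintel (unforcedness at the lintel's own
scale — this excludes the finger/slit witnesses W1 of triage r1-1/r1-2, which force every chord far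
away), the critical lip-to-lip chord reaches a site at distance `≥ C₀ · δ|W₁|` from EVERY lintel
vertex with probability `≤ 1/2` — whatever the walls (fractal, slit, drilled, two-sided lintel).
"x_c-arches are tight at the scale of their own lintel."  Scale-free (everything is proportional to
`δ`); junk-safe: `u = v` ⇒ the only chord is `nil`, whose unique site is at distance `δ < C₀ δ|W₁|`
from `u'`, so the event is empty; a disconnected room with the lips off the largest component has no
joining walk.  Its lattice-width lintels (`|W₁| = 1, 2`) contain the tail of the rooted half-plane
polygon mass at `x_c` (the critical-bubble input, ideator's BN-A / stmt-7117): believed, open. -/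
def RootedExitBound : Prop :=
  ∀ C₁ : ℝ, 1 ≤ C₁ → ∃ C₀ : ℝ, C₁ < C₀ ∧
    ∀ (δ : ℝ) (u v u' v' : Site 2) (W₁ : (zdGraph 2).Walk u' v') (W₂ : (zdGraph 2).Walk v' u'),
      0 < δ → (zdGraph 2).Adj u u' → (zdGraph 2).Adj v v' → 1 ≤ W₁.length →
      (∃ p : (discreteDomainGraph (encl δ (W₁.append W₂)) δ).Walk u v,
        ∀ s ∈ p.support, ∃ q ∈ W₁.support,
          dist (meshPoint δ s) (meshPoint δ q) ≤ C₁ * (δ * W₁.length)) →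
      SAW.law (encl δ (W₁.append W₂)) δ u v
          {γ | ∃ s ∈ γ.walk.support, ∀ q ∈ W₁.support,
            C₀ * (δ * W₁.length) ≤ dist (meshPoint δ s) (meshPoint δ q)} ≤ 1 / 2

/-- **Rooted dive bound** (seed 2, the AIMING step; the card's first lemma `RootedAnnulusBound`,
REPAIRED as required by triage r1-1 W1 / r1-2 (finger witness) / r1-3 (`C₀ > 2`)): there is `C₀ > 2`
such that for every mesh `δ`, every rooted room, every target ball `B̄(z₀, r)` with the mesh floor
`δ ≤ r`, if the LINTEL stays outside `B(z₀, C₀ r)` and the lips are joined inside the room by a lattice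
walk staying outside `B̄(z₀, C₀ r / 2)` (the unforcedness clause: a wall finger forcing every chord
through a one-site gap at `z₀` — law `= 1` for the unrepaired statement — violates it; forcing at
distances `≥ C₀ r / 2` is allowed and costs the chord a further factor `(2/C₀)^{exponent}` to reach the
ball), then the critical lip-to-lip chord meets `B̄(z₀, r)` with probability `≤ 1/2`, uniformly in the
walls and in the position of the target.  Junk-safe: `u = v` ⇒ the joining clause puts `δu` outside
`B̄(z₀, C₀ r/2) ⊇ B̄(z₀, r)`, so `nil` misses the event (law `0`); `W₁ = nil` is a genuine instance
(both lips adjacent to one boundary vertex far from the target).  Entropic forcing by a thin near route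
and a wide far route is impossible in `encl`-rooms (free-loop lemma: the two routes would enclose wall
material, `Negative.noFloatingHoles`).  Width-2 mouths again contain the rooted-loop tail. -/
def RootedDiveBound : Prop :=
  ∃ C₀ : ℝ, 2 < C₀ ∧
    ∀ (δ : ℝ) (u v u' v' : Site 2) (W₁ : (zdGraph 2).Walk u' v') (W₂ : (zdGraph 2).Walk v' u')
      (z₀ : ℂ) (r : ℝ), 0 < δ → δ ≤ r → (zdGraph 2).Adj u u' → (zdGraph 2).Adj v v' →
      (∀ q ∈ W₁.support, C₀ * r ≤ dist (meshPoint δ q) z₀) →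
      (∃ p : (discreteDomainGraph (encl δ (W₁.append W₂)) δ).Walk u v,
        ∀ s ∈ p.support, C₀ * r / 2 < dist (meshPoint δ s) z₀) →
      SAW.law (encl δ (W₁.append W₂)) δ u v
          {γ | ∃ s ∈ γ.walk.support, dist (meshPoint δ s) z₀ ≤ r} ≤ 1 / 2

/-- **Kemppainen–Smirnov's time-zero Condition G1 for the ADMISSIBLE family** — VERBATIM the shared
route item `Summit.CriticalPhenomena.SAWScalingLimit.Theses.SAWParafermion.KSAdmissibleG1`
(stmt-CriticalPhenomena-11346; copied here so that the skeleton imports only its own route file; the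
two decls are `Iff.rfl`).  There is `C > 1` such that for every finite `S ⊆ ℤ²` inducing a connected
subgraph with connected complement (a simply connected polyomino), every mesh `δ > 0`, all boundary
vertices `a, b` of `S`, and every annulus `A(z₀, r, R)` with `R ≥ C r`, the critical SAW in `S` from
`a` to `b` — `SAW.law` of the square-cell domain `U(S, δ) = interior ⋃_{v ∈ S} (closed δ-square at δv)`,
whose discretisation is the subgraph of `ℤ²` induced on `S` — makes a crossing of `A` contained in the
avoidable part `A^u` (KS eq. (3), `unforcedPartZero`, computed in `U(S, δ)`) with probability `≤ 1/2`
(`ConditionG1`).  By KS §4.1.6 the family is stable under the SAW's exact domain Markov property, so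
this is Condition G2 for boundary starts (arXiv:1212.6215, Remark 2.8). -/
def AdmissibleG1 : Prop :=
  ConditionG1 {L : MarkedLaw | ∃ (S : Finset (Site 2)) (δ : ℝ) (a b : Site 2),
    let U : Set ℂ := interior (⋃ v ∈ S, {z : ℂ | |z.re - (meshPoint δ v).re| ≤ δ / 2 ∧
      |z.im - (meshPoint δ v).im| ≤ δ / 2});
    0 < δ ∧ ((zdGraph 2).induce (↑S : Set (Site 2))).Preconnected ∧
    ((zdGraph 2).induce ((↑S : Set (Site 2))ᶜ)).Preconnected ∧ a ∈ S ∧ b ∈ S ∧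
    (∃ w ∉ S, (zdGraph 2).Adj a w) ∧ (∃ w ∉ S, (zdGraph 2).Adj b w) ∧
    L = ⟨U, meshPoint δ a, meshPoint δ b, (SAW.law U δ a b).map (fun γ => γ.curve)⟩}

/-- **Tame mesh**: at mesh `δ` the discrete domain `Ω_δ = meshDomain Ω δ` is a finite simply connected
polyomino (`S` connected, `ℤ² ∖ S` connected: no lattice holes), the mesh graph of `Ω` is INDUCED on it
(no edge of `ℤ²` between two sites of `Ω_δ` is dropped because its segment leaves `Ω̄`), and the two
endpoints are BOUNDARY VERTICES of `S` (a `ℤ²`-neighbour outside `S`).  Then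
`discreteDomainGraph Ω δ = discreteDomainGraph (U(S, δ)) δ` and the chordal SAW law of `Ω_δ` is a member
of the admissible family together with all its conditional futures.  The binders mirror those of
`AdmissibleG1`.  Every convex domain, with endpoints adjacent to the outside, is tame at every small
mesh; a Jordan domain fails to be tame only through boundary features below the mesh scale. -/
def IsTameMesh (Ω : Set ℂ) (δ : ℝ) (a b : Site 2) : Prop :=
  ∃ S : Finset (Site 2), (↑S : Set (Site 2)) = meshDomain Ω δ ∧
    ((zdGraph 2).induce (↑S : Set (Site 2))).Preconnected ∧
    ((zdGraph 2).induce ((↑S : Set (Site 2))ᶜ)).Preconnected ∧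
    (∀ x ∈ S, ∀ y ∈ S, (zdGraph 2).Adj x y → (discreteDomainGraph Ω δ).Adj x y) ∧
    a ∈ S ∧ b ∈ S ∧ (∃ w ∉ S, (zdGraph 2).Adj a w) ∧ (∃ w ∉ S, (zdGraph 2).Adj b w)

/-- **(H1) for eventually-tame endpoint approximations** — the conclusion of the route's
`SAWTraversalBound` (shell-dependent threshold `k`, `K ≥ 0`, `λ > 2`, `δ₀ > 0`), asserted only for
those Dobrushin domains and endpoint approximations whose meshes are tame for all small `δ`.  This is
the class on which Kemppainen–Smirnov's exploration argument stays inside the admissible family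
(Disproof F3: it is exactly the repair class (R1) intersected with mesh-tameness of `∂D`). -/
def TameTraversalBound : Prop :=
  ∀ (D : DobrushinDomain) (a b : ℝ → Site 2), SAW.IsEndpointApprox D a b →
    (∀ᶠ δ in 𝓝[>] (0 : ℝ), IsTameMesh D.carrier δ (a δ) (b δ)) →
    ∃ (k : ℂ → ℝ → ℝ → ℕ) (K lam δ₀ : ℝ), 0 ≤ K ∧ 2 < lam ∧ 0 < δ₀ ∧
      ∀ δ ∈ Set.Ioc (0 : ℝ) δ₀, ∀ (x : ℂ) (ρ R : ℝ), δ ≤ ρ → ρ < R → R ≤ 1 →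
        SAW.law D.carrier δ (a δ) (b δ)
            {γ | (⟨γ.walk.toCurve (meshPoint δ)⟩ : Curve ℂ).HasTraversals (k x ρ R) x ρ R}
          ≤ ENNReal.ofReal (K * (ρ / R) ^ lam)

/-! ## Stubs (registered; `sorry` only here) -/

/-- STUB 1 (seed, OPEN; expansion step) — rooted exit bound.  Model case: the card's `TExitBound`
(flat ceiling of width `n`, T-domain; exact enumeration of rooted dives decays ≈ 3× per row of depth). -/
theorem stub_exitSeed : RootedExitBound := by
  sorry

/-- STUB 2 (seed, OPEN; aiming step; the card's repaired first lemma) — rooted dive bound.  Toy data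
(card, exp/carve.py): every rooted room `≤ 6×5` with lintel distance `≥ 3r` has dive probability
`≤ 0.40`; geometric decay in depth (`.330/.108/.034`, `.520/.182/.056/.016`). -/
theorem stub_diveSeed : RootedDiveBound := by
  sorry

/-- STUB 3 (the line's NEW mathematics, XL but charted; the ONLY place `LeftRightFKG` enters) —
RE-ROOTING: PA (through its hull monotonicities + exact restriction) + bead factorisation at collar
necks + the two seeds chained along the gates of each avoidable pocket (a Beurling-type bound
`P(reach arc I) ≤ K exp(-ε ℓ(I))`) + Kemppainen–Smirnov's separating-arcs induction
(arXiv:1212.6215 pp. 11–12) give Condition G1 for the admissible family. -/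
theorem stub_reroot : LeftRightFKG → RootedExitBound → RootedDiveBound → AdmissibleG1 := by
  sorry

/-- STUB 4 (Kemppainen–Smirnov vendored for the chordal critical SAW, XL but charted) — on TAME meshes
the SAW law of `D_δ` is the admissible law of `U(S, δ)` (equal graphs), its conditional futures stay
admissible (KS §4.1.6), G1 ⇒ G3 by concentric iteration (KS p. 11: `2 (r/R)^{log 2 / log C}`), and the
index argument (KS Lemma 3.6 / Prop. 3.5) bounds `k = N₀(x,ρ,R) + 2j` separate traversals by
`2^j K^j (ρ/R)^{jΔ/3}`; `N₀` = the number of crossings forced on lattice paths `a_δ → b_δ` by `∂D`,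
bounded uniformly in `δ ≤ δ₀` for a Jordan domain (uniform continuity of the boundary loop). -/
theorem stub_ksDownstream : AdmissibleG1 → TameTraversalBound := by
  sorry

/-- STUB 5 (OPEN; NOT this line's mechanism — the statement-level residue shared by every line on
this crux) — from eventually-tame approximations to ALL Dobrushin domains and ALL endpoint
approximations: (i) deep endpoints (Disproof F3; triage X1/S1/P1 — needs interior/whole-plane return
estimates for the critical SAW, or the route planner's repair (R1)), (ii) Jordan boundaries that are
rough below the mesh scale at infinitely many meshes (non-induced mesh edges, lattice holes). -/
theorem stub_classExtension : TameTraversalBound → SAWTraversalBound := by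
  sorry

/-! ## Proved: the complement form of PA (the formal core of CARVE / FILL) -/

/-- **PA in complement form.**  If a measure `w` of finite total mass is positively associated for an
order `le` (`w(A) w(B) ≤ w(univ) w(A ∩ B)` for `le`-up-closed `A, B`), then an up-closed `E` and a
DOWN-closed `D` are negatively correlated: `w(E ∩ D) · w(univ) ≤ w(E) · w(D)`.  (Apply PA to `E` and
`Dᶜ`, split `w(E) = w(E ∩ D) + w(E ∩ Dᶜ)`, `w(univ) = w(D) + w(Dᶜ)`, cancel the finite cross term.) -/
theorem inter_mul_univ_le_of_PA {ι : Type*} [MeasurableSpace ι] {le : ι → ι → Prop} {w : Measure ι}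
    (hPA : ∀ A B : Set ι, (∀ γ₁ γ₂, le γ₁ γ₂ → γ₁ ∈ A → γ₂ ∈ A) →
      (∀ γ₁ γ₂, le γ₁ γ₂ → γ₁ ∈ B → γ₂ ∈ B) → w A * w B ≤ w Set.univ * w (A ∩ B))
    (hU : w Set.univ ≠ ⊤) {E D : Set ι} (hDm : MeasurableSet D)
    (hE : ∀ γ₁ γ₂, le γ₁ γ₂ → γ₁ ∈ E → γ₂ ∈ E) (hD : ∀ γ₁ γ₂, le γ₁ γ₂ → γ₂ ∈ D → γ₁ ∈ D) :
    w (E ∩ D) * w Set.univ ≤ w E * w D := by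
  have hDc : ∀ γ₁ γ₂, le γ₁ γ₂ → γ₁ ∈ Dᶜ → γ₂ ∈ Dᶜ := fun γ₁ γ₂ h h₁ h₂ => h₁ (hD γ₁ γ₂ h h₂)
  have key := hPA E Dᶜ hE hDc
  have fin : ∀ S : Set ι, w S ≠ ⊤ := fun S =>
    ((measure_mono (Set.subset_univ S)).trans_lt hU.lt_top).ne
  set a := w (E ∩ D) with ha
  set b := w (E ∩ Dᶜ) with hb
  set d := w D with hd
  set d' := w Dᶜ with hd'
  have hEsplit : w E = a + b := by
    rw [ha, hb, ← Set.sdiff_eq]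
    exact (measure_inter_add_sdiff E hDm).symm
  have hUsplit : w Set.univ = d + d' := by
    rw [hd, hd']
    exact (measure_add_measure_compl hDm).symm
  rw [hEsplit, hUsplit] at key
  -- `key : (a + b) * d' ≤ (d + d') * b`; cancel `b * d'`
  have h1 : a * d' + b * d' ≤ d * b + b * d' := by
    calc a * d' + b * d' = (a + b) * d' := by ring
      _ ≤ (d + d') * b := key
      _ = d * b + b * d' := by ring
  have hbd' : b * d' ≠ ⊤ := ENNReal.mul_ne_top (fin _) (fin _)
  have h2 : a * d' ≤ d * b := (ENNReal.add_le_add_iff_right hbd').1 h1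
  calc a * w Set.univ = a * d + a * d' := by rw [hUsplit]; ring
    _ ≤ a * d + d * b := add_le_add le_rfl h2
    _ = (a + b) * d := by ring
    _ = w E * d := by rw [hEsplit]

/-- **CARVE core for the route's order and weight** (the card's `CarveCore`, = `Sketch.Sandwich` of
card carve-fill-sandwich, = the input of (M−)/(M+) of card lid-collapse-needle; triage X3): under
`LeftRightFKG`, in every domain of its class an `lr`-up-closed event `E` (e.g. "the chord enters a
pocket hanging off the right arc") and an `lr`-down-closed event `D` (e.g. "the chord avoids a hull
attached to the right arc", whose conditioning is the chord law of the excised domain by the exact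
restriction property) satisfy `w(E ∩ D)·w(univ) ≤ w(E)·w(D)`.  Finiteness of the total weight is kept
as a hypothesis here (it holds for every `δ > 0`: `encl δ C` is bounded and `DomainSAW` is then finite,
cf. `finite_domainSAW_of_isBounded`). -/
theorem carveCore_of_leftRightFKG (hPA : LeftRightFKG) (δ : ℝ) (c a b a' b' : Site 2)
    (C : (zdGraph 2).Walk c c) (hδ : 0 < δ) (ha' : a' ∈ C.support) (hb' : b' ∈ C.support)
    (haa : (zdGraph 2).Adj a a') (hbb : (zdGraph 2).Adj b b')
    (hU : SAW.weight (encl δ C) δ a b Set.univ ≠ ⊤)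
    (E D : Set (SAW.DomainSAW (encl δ C) δ a b))
    (hE : ∀ γ₁ γ₂, lr δ C a b γ₁ γ₂ → γ₁ ∈ E → γ₂ ∈ E)
    (hD : ∀ γ₁ γ₂, lr δ C a b γ₁ γ₂ → γ₂ ∈ D → γ₁ ∈ D) :
    SAW.weight (encl δ C) δ a b (E ∩ D) * SAW.weight (encl δ C) δ a b Set.univ ≤
      SAW.weight (encl δ C) δ a b E * SAW.weight (encl δ C) δ a b D :=
  inter_mul_univ_le_of_PA (le := lr δ C a b) (hPA δ c a b a' b' C hδ ha' hb' haa hbb) hU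
    MeasurableSpace.measurableSet_top hE hD

/-! ## Composition (sorry-free over the stubs) -/

/-- The residue is exactly the gap: the route's (H1) trivially implies its tame restriction. -/
theorem tameTraversalBound_of_sawTraversalBound (h : SAWTraversalBound) : TameTraversalBound :=
  fun D a b hab _ => h D a b hab

/-- **`FKGToTraversalBound` from the five stubs** — the skeleton theorem audited by
`#h21_check_skeleton`: it concludes the route decl BY NAME.  Read as an implication between the stub
statements it is `RootedExitBound → RootedDiveBound → (LeftRightFKG → RootedExitBound →
RootedDiveBound → AdmissibleG1) → (AdmissibleG1 → TameTraversalBound) → (TameTraversalBound →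
SAWTraversalBound) → FKGToTraversalBound`, proved by `fun hE hD hR hK hX hPA => hX (hK (hR hPA hE hD))`:
PA and the two seeds are consumed by the re-rooting stub, which yields Condition G1 for the admissible
family; the Kemppainen–Smirnov downstream turns it into (H1) on eventually-tame approximations; the
class-extension stub is the named residue. -/
theorem FKGToTraversalBound_of : FKGToTraversalBound :=
  fun hPA => stub_classExtension (stub_ksDownstream (stub_reroot hPA stub_exitSeed stub_diveSeed))

end Summit.CriticalPhenomena.SAWScalingLimit.Cruxes.FKGToTraversalBound.CarveRerootDrill

end
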